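import Summits.QuantumFields.YangMills.Theorems.F4SubCurvatureDoorFibreReductionSymmetry
import Summits.QuantumFields.YangMills.Theorems.F4SubCurvatureDoorFibreReductionRadial
import Mathlib
import HarnessLib

/-!
# LINE g21-B «fibre dichotomy» (⟨stmt-QuantumFields-23125⟩ `F4SubCurvatureDoor.RationalToGeneral`) — registered stub B5
# `stub_fibreReduction : FibreReduction`, BY NAME AND SIGNATURE

Skeleton `Cruxes/RationalToGeneral/Lines/fibre_dichotomy.lean` (:92–104, :161–165, :176).  The Props `InClass₀`, `ShellSeparated` and
`FibreReduction` are restated CHARACTER-IDENTICALLY (vocabulary: `massSq` = the verbatim copy in ns `…F4SubCurvatureDoorShellLFAnalytic`;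
`SingleShellDichotomy` = the verbatim copy of the landed stub B4 in ns `…SingleShellDichotomyRegistered`; `E4`, `E3`, `InClass`, `IsLF` from
`…LaplaceFourierRegistered`) and PROVED:

`stub_fibreReduction : FibreReduction` — given the single-shell dichotomy, a class kernel whose Laplace–Fourier measure is carried by the forward
cone and shell-separated is radial off the origin.

ASSEMBLY (all inputs are tree theorems): disintegrate `e^{−E}μ` along `massSq` (✓`disintegration_package`, Mathlib `Measure.condKernel`);
a.e. fibre is a shell measure (✓`ae_isShellMeasure`) and LF-symmetric (✓`ae_symmetricLF`: every window kernel of the shell separation is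
`D₄`-invariant; countable dense family of pairs `(R, x)` + continuity of the fibre transforms off the mirror); the axis budget R-B5a
(✓`axisBudget_holds`) and Fatou kill B4's growth alternative in a.e. fibre (✓`ae_radial`); the radial fibres integrate back to `K` off the mirror
(✓`window_kernel_eq` with the trivial window, ✓`kernel_eq_of_norm_eq`), and the mirror `x₀ = 0` is reached by a coordinate swap (a `D₄`-isometry
fixing `K`).

Mathlib + tree only; no `sorry`; standard axioms.  HONEST LABEL: this closes the registered stub B5 of the OPEN line g21-B only (B4 ✓p724005);
the line now rests on its two shared stubs S1 `stub_forwardConeSupport` (XL) and S2 `stub_shellSeparation`; the crux ⟨23125⟩, its parent ⟨23035⟩,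
rung R2d and the Yang–Mills mass gap remain OPEN; no summit is proved by a line.  Seat `ym-line-frs-p2` g16 (cell ym-idea-3, free hands).
-/

noncomputable section

open MeasureTheory MeasureTheory.Measure Set Function Filter Topology ProbabilityTheory
open scoped BigOperators ENNReal

namespace Summit.QuantumFields.YangMills.Theorems.F4SubCurvatureDoorFibreReductionRegistered

open Literature.MathematicalPhysics.QuantumLattice (timeReflection siteToE)
open Summit.QuantumFields.YangMills.Cruxes.OSLegsAtWeakCouplingC.Sketch (IsSignedPerm)
open Summit.QuantumFields.YangMills.Theorems.F4SubCurvatureDoorLaplaceFourierRegistered (E4 E3 InClass timeSpace IsLF)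
open Summit.QuantumFields.YangMills.Theorems.F4SubCurvatureDoorFibreDichotomyAxis (spacePart lfEval IsD4Isometry SymmetricLF signIso
  isD4Isometry_signIso axisBudget_holds)
open Summit.QuantumFields.YangMills.Theorems.F4SubCurvatureDoorShellLFAnalytic (massSq IsShellMeasure)
open Summit.QuantumFields.YangMills.Theorems.F4SubCurvatureDoorSingleShellDichotomyRegistered (SingleShellDichotomy)
open Summit.QuantumFields.YangMills.Theorems.F4SubCurvatureDoorMirrorPatchingRegistered (swapIso timeIdx swapIso_apply_zero isD4Isometry_swapIso
  apply_timeIdx_ne_zero)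
open Summit.QuantumFields.YangMills.Theorems.F4SubCurvatureDoorFibreReduction (disintegration_package window_kernel_eq ae_symmetricLF ae_radial
  kernel_eq_of_norm_eq)

/-! ## The registered texts (verbatim from `Lines/fibre_dichotomy.lean`) -/

/-- The BUDGET-FREE class (verbatim from g21-A). -/
def InClass₀ (K : E4 → ℝ) : Prop :=
  ContinuousOn K {x | x ≠ 0} ∧
  (∃ C : ℝ, ∀ x, 1 ≤ ‖x‖ → |K x| ≤ C) ∧
  (∀ R : E4 ≃ₗᵢ[ℝ] E4, IsSignedPerm R → ∀ x, K (R x) = K x) ∧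
  (∀ (m : ℕ) (x : Fin m → E4) (c : Fin m → ℝ), (∀ i, 0 < x i 0) →
      0 ≤ ∑ i, ∑ j, c i * c j * K (timeReflection 4 (x i) - x j)) ∧
  (∀ R : E4 ≃ₗᵢ[ℝ] E4,
      (∀ z : Fin 4 → ℤ, Even (∑ i, z i) → ∃ w : Fin 4 → ℤ, Even (∑ i, w i) ∧ R (siteToE z) = siteToE w) →
      ∀ x, K (R x) = K x)

/-- `μ` is SHELL-SEPARATED (verbatim from g21-A). -/
def ShellSeparated (μ : Measure (ℝ × E3)) : Prop :=
  ∀ S : Set ℝ, MeasurableSet S → ∃ KS : E4 → ℝ, InClass₀ KS ∧ IsLF KS (μ.restrict (massSq ⁻¹' S))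

/-- Stub B5 «FIBRE REDUCTION» (M; disintegration + Fatou): given the single-shell dichotomy, a class kernel whose Laplace–Fourier measure is
carried by the forward cone and shell-separated is radial off `0`.  Content: disintegrate the finite measure `e^{−E}μ` along `massSq`
(`Measure.condKernel` on a standard Borel space) into probability fibres; a.e. fibre is Laplace-integrable (Tonelli), single-shell, cone-carried,
and LF-symmetric (shell separation tested on a countable generating family of mass windows × a countable dense set of points × the finite
group); the axis identity `t⁸ K(t e₀) = ∫ t⁸ L_{ν_s}(t) dρ(s) → 0` (budget = fifth conjunct of `InClass`) and Fatou (`lintegral_liminf_le`)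
exclude the dichotomy's second alternative a.e.; integrate the radial fibres back and extend across the mirror by symmetry of `K`.
[Mathlib `ProbabilityTheory.condKernel`, `MeasureTheory.lintegral_liminf_le`]  WHY IT MIGHT FAIL: Lean plumbing only (kernels, a.e. swaps). -/
def FibreReduction : Prop :=
  SingleShellDichotomy →
    ∀ K : E4 → ℝ, InClass K → ∀ μ : Measure (ℝ × E3), IsLF K μ →
      μ {p | p.1 < ‖p.2‖} = 0 → ShellSeparated μ →
      ∃ g₀ : ℝ → ℝ, ∀ x : E4, x ≠ 0 → K x = g₀ (‖x‖ ^ 2)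

/-! ## The proof -/

/-- **REGISTERED STUB B5 `stub_fibreReduction` OF LINE g21-B, BY NAME AND SIGNATURE: `FibreReduction` holds.** -/
theorem stub_fibreReduction : FibreReduction := by
  intro hB4 K hK μ hLF hcone hsep
  -- the disintegration package of `μ` along the squared mass
  obtain ⟨η, ν, hηfin, hνsf, hdis, hfib, hcone'⟩ := disintegration_package μ (hLF.2.1 1 one_pos) hcone
  haveI := hηfin
  haveI := hνsf
  have hint : ∀ t : ℝ, 0 < t → Integrable (fun p : ℝ × E3 => Real.exp (-(t * p.1))) μ := hLF.2.1
  -- shell separation: every window kernel is `D₄`-invariant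
  have hwin : ∀ S : Set ℝ, MeasurableSet S → ∃ KS : E4 → ℝ, IsLF KS (μ.restrict (massSq ⁻¹' S)) ∧
      ∀ R : E4 ≃ₗᵢ[ℝ] E4, IsD4Isometry R → ∀ x : E4, KS (R x) = KS x := by
    intro S hS
    obtain ⟨KS, hKS, hLFS⟩ := hsep S hS
    exact ⟨KS, hLFS, fun R hR x => hKS.2.2.2.2 R hR x⟩
  -- a.e. fibre is LF-symmetric and radial
  have hsymm := ae_symmetricLF hdis hfib hcone' hint hwin
  have hbudget := axisBudget_holds K μ hK hLF
  have hrad := ae_radial hB4 hdis hfib hcone' hint hsymm hbudget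
  -- off the mirror `K` is the superposition of the fibre transforms, hence depends on the norm only
  have hKint : ∀ x : E4, x 0 ≠ 0 → K x = ∫ s, lfEval (ν s) x ∂η := by
    intro x hx
    have hLF' : IsLF K (μ.restrict (massSq ⁻¹' (univ : Set ℝ))) := by rwa [preimage_univ, Measure.restrict_univ]
    have h := window_kernel_eq hdis hfib hcone' hint MeasurableSet.univ hLF' (fun y => hK.2.2.2.2.2 _ (isD4Isometry_signIso _) y) hx
    rwa [Measure.restrict_univ] at h
  have heq : ∀ x y : E4, x 0 ≠ 0 → y 0 ≠ 0 → ‖x‖ = ‖y‖ → K x = K y := fun x y hx hy hxy =>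
    kernel_eq_of_norm_eq hKint hrad hx hy hxy
  -- the radial profile, read on the positive time axis
  set e : E4 := EuclideanSpace.single 0 (1 : ℝ) with he
  refine ⟨fun v => K (Real.sqrt v • e), fun x hx => ?_⟩
  have hnx : 0 < ‖x‖ := norm_pos_iff.2 hx
  have he1 : ‖e‖ = 1 := by simp [he, PiLp.norm_single]
  have hax0 : (‖x‖ • e) 0 = ‖x‖ := by simp [he]
  have hax : (‖x‖ • e) 0 ≠ 0 := by rw [hax0]; exact hnx.ne'
  have hnorm : ‖‖x‖ • e‖ = ‖x‖ := by rw [norm_smul, he1, mul_one, norm_norm]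
  show K x = K (Real.sqrt (‖x‖ ^ 2) • e)
  rw [Real.sqrt_sq hnx.le]
  by_cases hx0 : x 0 ≠ 0
  · exact heq x _ hx0 hax hnorm.symm
  · -- on the mirror: swap a non-vanishing coordinate into the time slot (a `D₄`-isometry fixing `K`)
    set y : E4 := swapIso (timeIdx x) x with hy
    have hy0 : y 0 ≠ 0 := by rw [hy, swapIso_apply_zero]; exact apply_timeIdx_ne_zero x hx
    have hKy : K y = K x := hK.2.2.2.2.2 _ (isD4Isometry_swapIso _) x
    have hny : ‖y‖ = ‖x‖ := LinearIsometryEquiv.norm_map _ _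
    rw [← hKy]
    exact heq y _ hy0 hax (by rw [hny, hnorm])

end Summit.QuantumFields.YangMills.Theorems.F4SubCurvatureDoorFibreReductionRegistered

end
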